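import Literature.NumberTheory.GaloisRepresentations.LAdicCharacterUnramifiedAEProofs
import Literature.NumberTheory.GaloisRepresentations.LocalUnitsPrimeToPProofs
import Literature.NumberTheory.GaloisRepresentations.IdelicCharacterProofs
import Mathlib.Analysis.SpecialFunctions.Complex.Log
import Mathlib.Analysis.SpecificLimits.Basic
import HarnessLib

/-!
# Values of an `ℓ`-adic idele class character at global elements (proved)

Topic `NumberTheory/GaloisRepresentations`; namespace
`Literature.NumberTheory.GaloisRepresentations.IdelicCharacter`.  A *proofs* file (theorems only;
no definition, no named fact, no instance).

Let `K` be a number field and `Ψ : 𝕀_K →ₜ* Aˣ` a continuous character of the idele group with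
values in the units of an ultrametric normed field `A` (for `A = ℚ̄_ℓ = PadicAlgCl ℓ` these are the
idele class characters `ψ ∘ Art_K` of the `ℓ`-adic Galois characters `ψ`, Böckle–Hui §2.3, tree:
`FramedGaloisRep.exists_idelicCharacter`), trivial on `Kˣ` and *unramified outside a finite set
`S`* of finite places (`Ψ(⟨𝒪_vˣ⟩_v) = 1` for `v ∉ S`).  Serre's proof that `E`-rational abelian
`ℓ`-adic representations are locally algebraic (*Abelian `ℓ`-adic representations*, Ch. III §2–§3;
BH §2.4, Thm. 2.2) feeds the transcendence theorem with the continuous function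
`f = Ψ|_{∏_{v ∣ ℓ} K_vˣ}` and its values at global elements `k ∈ Kˣ`, which the product formula
`Ψ(k) = 1` expresses through the values `Ψ(⟨ϖ_v⟩_v) = ψ(Frob_v)` at the primes of `k` away from
`S`.  This file proves that computation:

* `map_eq_one_of_forall_valued_eq_one` — `Ψ` kills every idele supported on units away from `S`
  and trivial at `S ∪ ∞` (closure of finite products of local units; `ker Ψ` is closed).
* `map_infiniteIdeles_mul_prod_localUnits_eq_one` — **product formula**: for `k ∈ Kˣ` and a
  finite `S' ⊇ S` outside which `k` is a unit, `Ψ((k)_∞) · ∏_{v ∈ S'} Ψ(⟨k⟩_v) = 1` (Neukirch VII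
  (6.13), proof, for `ℓ`-adic instead of finite-order characters).
* `map_localUnits_eq_zpow_of_valued` — at an unramified `v`, `Ψ(⟨z⟩_v) = Ψ(⟨ϖ_v⟩_v)^m` for
  `|z|_v = q_v^{-m}`.
* `exists_pow_map_localUnits_eq_one_of_not_mem` — **at `v ∤ ℓ` the local units have finite image
  under an `ℓ`-adic character**: `Ψ(⟨u⟩_v)^N = 1` for all `u ∈ 𝒪_vˣ` (`A = ℚ̄_ℓ`; the one-units of
  `K_v` form a pro-`p` group, `p ≠ ℓ`, while the one-units of `ℚ̄_ℓ` have no prime-to-`ℓ` torsion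
  and `‖z^{p^j} - 1‖ = ‖z - 1‖`; cf. the tree's `ℤ_p`-valued twin
  `OneUnits.continuousMonoidHom_eq_one_of_not_mem`).
* `map_infiniteIdeles_sq_eq_one` — **the archimedean components die on squares**: `Ψ((x²)_∞) = 1`
  for every infinite idele `x` (squares have `n`-th roots tending to `1` in `ℝˣ`, `ℂˣ`, and `Aˣ`
  has arbitrarily small open subgroups).
* `exists_pow_prod_map_localUnits_eq` — **Serre's formula**: there is `N ≥ 1` such that for every
  `k ∈ Kˣ` which is a unit at the places of `S` not above `ℓ`,
  `(∏_{v ∈ S, v ∣ ℓ} Ψ(⟨k⟩_v))^N · (∏_{v ∈ T} Ψ(⟨k⟩_v))^N = 1` for every finite `T` disjoint from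
  `S` outside which (and `S`) `k` is a unit; with `map_localUnits_eq_zpow_of_valued` the second
  factor is `∏_{v ∈ T} Ψ(⟨ϖ_v⟩_v)^{N · ord_v k}`.
* `isAlgebraic_prod_map_localUnits` — consequently, **if the Frobenius values `Ψ(⟨ϖ_v⟩_v)`,
  `v ∉ S`, are algebraic, then so is `f(k) = ∏_{v ∈ S, v ∣ ℓ} Ψ(⟨k⟩_v)`** for every such `k`: the
  hypothesis of the `ℓ`-adic transcendence theorem (Serre III §3; Waldschmidt / Henniart, BH
  Thm. 2.2) in analytic form.

## References

* J.-P. Serre, *Abelian ℓ-adic representations and elliptic curves* (1968), Ch. II §2–§3,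
  Ch. III §2–§3. [SerreAbelianLadic1968]
* G. Böckle, C.-Y. Hui, Math. Ann. 393 (2025), §2.3–§2.4, Thm. 2.2. [BockleHui2025]
* J. Neukirch, *Algebraic Number Theory* (1999), Ch. VI §1, Ch. VII §6 (6.13). [NeukirchANT1999]
* L. C. Washington, *Introduction to Cyclotomic Fields*, §13.1 (the `ℤ_p`-valued case).
-/

noncomputable section

open scoped NumberField Topology
open NumberField IsDedekindDomain IsDedekindDomain.HeightOneSpectrum Filter

namespace Literature.NumberTheory.GaloisRepresentations

namespace IdelicCharacter

variable {K : Type*} [Field K] [NumberField K]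

/-! ### Local units of valuation one -/

/-- An element of `K_vˣ` of valuation `1` is (the image of) a unit of `𝒪_v`. [folklore] -/
theorem exists_unitsMap_eq_of_valued_eq_one {v : HeightOneSpectrum (𝓞 K)}
    (w : (v.adicCompletion K)ˣ) (hw : Valued.v (w : v.adicCompletion K) = 1) :
    ∃ u : (v.adicCompletionIntegers K)ˣ,
      Units.map ((v.adicCompletionIntegers K).subtype : _ →* _) u = w := by
  have hw' : Valued.v ((w⁻¹ : (v.adicCompletion K)ˣ) : v.adicCompletion K) = 1 := by
    rw [Units.val_inv_eq_inv_val, map_inv₀, hw, inv_one]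
  let u : (v.adicCompletionIntegers K)ˣ :=
    ⟨⟨(w : v.adicCompletion K), hw.le⟩, ⟨((w⁻¹ : (v.adicCompletion K)ˣ) : v.adicCompletion K),
      hw'.le⟩, Subtype.ext w.mul_inv, Subtype.ext w.inv_mul⟩
  exact ⟨u, Units.ext rfl⟩

/-! ### `Ψ` kills the ideles supported on units away from `S` -/

section General

variable {M : Type*} [CommGroup M] [TopologicalSpace M]

/-- **A continuous character of `𝕀_K` unramified outside `S` kills every idele `z` with `z_∞ = 1`,
`z_v = 1` for `v ∈ S` and `z_v ∈ 𝒪_vˣ` for all `v`** (`z` lies in the closure of the finite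
products `∏_{v ∈ T} ⟨z_v⟩_v`, each killed, and `ker Ψ` is closed).  Ref: Tate, Cassels–Fröhlich
Ch. VII §4, proof of Prop. 4.1 (the factor `ψ((ax)_2)`); Neukirch VI §1. [folklore] -/
theorem map_eq_one_of_forall_valued_eq_one [T2Space M] (Ψ : ideleGroup K →ₜ* M)
    {S : Set (HeightOneSpectrum (𝓞 K))}
    (hS : ∀ v ∉ S, ∀ u : (v.adicCompletionIntegers K)ˣ,
      Ψ (localUnits v (Units.map ((v.adicCompletionIntegers K).subtype : _ →* _) u)) = 1)
    (z : ideleGroup K) (hz1 : (z : AdeleRing (𝓞 K) K).1 = 1)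
    (hzS : ∀ v ∈ S, (z : AdeleRing (𝓞 K) K).2 v = 1)
    (hzu : ∀ v, Valued.v ((z : AdeleRing (𝓞 K) K).2 v) = 1) : Ψ z = 1 := by
  classical
  have hcl : IsClosed {y : ideleGroup K | Ψ y = 1} := isClosed_eq Ψ.continuous continuous_const
  suffices hz : z ∈ closure {y : ideleGroup K | Ψ y = 1} by
    rw [hcl.closure_eq] at hz
    exact hz
  rw [mem_closure_iff_nhds]
  intro N hN
  have hN1 : {y : ideleGroup K | z * y ∈ N} ∈ 𝓝 (1 : ideleGroup K) := by
    have : N ∈ 𝓝 (z * 1) := by rwa [mul_one]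
    exact (continuous_const_mul z).continuousAt.preimage_mem_nhds this
  obtain ⟨T, hT, e, hTe⟩ := ideleGroup_exists_congruenceSubgroup_subset hN1
  -- the components of `z` as local units
  let w : ∀ q : HeightOneSpectrum (𝓞 K), (q.adicCompletion K)ˣ := fun q =>
    Units.mk0 ((z : AdeleRing (𝓞 K) K).2 q) (ideleGroup_snd_ne_zero z q)
  have hw : ∀ q, Valued.v ((w q : (q.adicCompletion K)ˣ) : q.adicCompletion K) = 1 := fun q => hzu q
  choose u hu using fun q => exists_unitsMap_eq_of_valued_eq_one (w q) (hw q)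
  set zT : ideleGroup K := ∏ q ∈ hT.toFinset, localUnits q (w q) with hzT
  have hΨzT : Ψ zT = 1 := by
    rw [hzT, map_prod]
    refine Finset.prod_eq_one fun q _ => ?_
    by_cases hq : q ∈ S
    · have h1 : w q = 1 := Units.ext (by simp [w, hzS q hq])
      rw [h1, map_one, map_one]
    · rw [← hu q]
      exact hS q hq (u q)
  refine ⟨zT, ?_, hΨzT⟩
  have hmem : z * (z⁻¹ * zT) ∈ N := by
    refine hTe (z⁻¹ * zT) ?_ ?_ ?_
    · rw [ideleGroup_val_fst_mul, fst_prod_localUnits, mul_one]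
      have := ideleGroup_val_inv_fst_mul z
      rwa [hz1, mul_one] at this
    · intro q
      rw [ideleGroup_val_snd_mul, ideleGroup_val_inv_snd, snd_prod_localUnits]
      split_ifs with hq
      · rw [Units.val_mk0, inv_mul_cancel₀ (ideleGroup_snd_ne_zero z q), map_one]
      · rw [mul_one, map_inv₀, hzu q, inv_one]
    · intro q hq
      have hq' : q ∈ hT.toFinset := hT.mem_toFinset.2 hq
      rw [ideleGroup_val_snd_mul, ideleGroup_val_inv_snd, snd_prod_localUnits, if_pos hq',
        Units.val_mk0, inv_mul_cancel₀ (ideleGroup_snd_ne_zero z q), sub_self, map_zero]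
      exact zero_le
  rwa [mul_inv_cancel_left] at hmem

/-- **Product formula for an unramified-outside-`S` idele class character at a principal idele**:
if `Ψ(Kˣ) = 1`, `Ψ(⟨𝒪_vˣ⟩_v) = 1` for `v ∉ S` (`S` finite) and `k ∈ Kˣ` is a unit outside `S`,
then `Ψ((k)_∞) · ∏_{v ∈ S} Ψ(⟨k⟩_v) = 1` — the idele `k · (k)_∞⁻¹ · ∏_{v ∈ S} ⟨k⟩_v⁻¹` is
supported on units away from `S`.  Ref: Neukirch, *Algebraic Number Theory*, Ch. VII §6, proof of
(6.13) (`a = a_f a_∞`); here for characters that need not have a modulus.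
[cite: NeukirchANT1999, Ch. VII §6 Prop. (6.13) (proof)] -/
theorem map_infiniteIdeles_mul_prod_localUnits_eq_one [T2Space M] (Ψ : ideleGroup K →ₜ* M)
    (hK : ∀ x ∈ principalIdeles K, Ψ x = 1)
    {S : Finset (HeightOneSpectrum (𝓞 K))}
    (hS : ∀ v ∉ S, ∀ u : (v.adicCompletionIntegers K)ˣ,
      Ψ (localUnits v (Units.map ((v.adicCompletionIntegers K).subtype : _ →* _) u)) = 1)
    (k : Kˣ) (hk : ∀ v ∉ S, v.valuation K (k : K) = 1) :
    Ψ (infiniteIdeles K (globalToInfiniteUnits K k)) *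
      ∏ v ∈ S, Ψ (localUnits v (globalToLocalUnits v k)) = 1 := by
  classical
  set P : ideleGroup K := principalIdele K k with hP
  set I : ideleGroup K := infiniteIdeles K (globalToInfiniteUnits K k) with hI
  set G : ideleGroup K := ∏ v ∈ S, localUnits v (globalToLocalUnits v k) with hG
  have hk0 : ∀ v : HeightOneSpectrum (𝓞 K), algebraMap K (v.adicCompletion K) k ≠ 0 := fun v =>
    (map_ne_zero _).2 k.ne_zero
  have hz : Ψ (P * I⁻¹ * G⁻¹) = 1 := by
    refine map_eq_one_of_forall_valued_eq_one Ψ (S := (S : Set (HeightOneSpectrum (𝓞 K))))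
      (fun v hv => hS v (by exact_mod_cast hv)) _ ?_ (fun w hw => ?_) (fun w => ?_)
    · rw [ideleGroup_val_fst_mul, ideleGroup_val_fst_mul, hP, principalIdele_fst]
      have h1 : algebraMap K (InfiniteAdeleRing K) k *
          ((I⁻¹ : ideleGroup K) : AdeleRing (𝓞 K) K).1 = 1 := by
        rw [mul_comm]; exact ideleGroup_val_inv_fst_mul I
      have h2 : ((G⁻¹ : ideleGroup K) : AdeleRing (𝓞 K) K).1 = 1 := by
        have := ideleGroup_val_inv_fst_mul G
        rwa [hG, fst_prod_localUnits, mul_one] at this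
      rw [h1, h2, mul_one]
    · have hw' : w ∈ S := by exact_mod_cast hw
      rw [ideleGroup_val_snd_mul, ideleGroup_val_snd_mul, ideleGroup_val_inv_snd,
        ideleGroup_val_inv_snd, hP, principalIdele_snd, hI, infiniteIdeles_snd, inv_one, mul_one,
        hG, snd_prod_localUnits, if_pos hw', val_globalToLocalUnits, mul_inv_cancel₀ (hk0 w)]
    · rw [ideleGroup_val_snd_mul, ideleGroup_val_snd_mul, ideleGroup_val_inv_snd,
        ideleGroup_val_inv_snd, hP, principalIdele_snd, hI, infiniteIdeles_snd, inv_one, mul_one,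
        hG, snd_prod_localUnits]
      split_ifs with hw
      · rw [val_globalToLocalUnits, mul_inv_cancel₀ (hk0 w), map_one]
      · rw [inv_one, mul_one, valued_algebraMap_adicCompletion]
        exact hk w hw
  have hPΨ : Ψ P = 1 := hK _ (principalIdele_mem k)
  rw [map_mul, map_mul, map_inv, map_inv, hPΨ, one_mul, ← mul_inv, inv_eq_one] at hz
  have hG' : ∏ v ∈ S, Ψ (localUnits v (globalToLocalUnits v k)) = Ψ G := by rw [hG, map_prod]
  rw [hG']
  exact hz

/-- **`Ψ(⟨z⟩_v) = Ψ(⟨ϖ⟩_v)^m` for `|z|_v = q_v^{-m}` at a place where `Ψ` kills `𝒪_vˣ`**, for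
any `ϖ ∈ K_v` of valuation one (`K_vˣ = ϖ^ℤ × 𝒪_vˣ`).  Ref: Neukirch, *Algebraic Number Theory*,
Ch. VII §6, after (6.12); Tate (1950) §2.5. [folklore] -/
theorem map_localUnits_eq_zpow_of_valued (Ψ : ideleGroup K →ₜ* M) {v : HeightOneSpectrum (𝓞 K)}
    (hv : ∀ u : (v.adicCompletionIntegers K)ˣ,
      Ψ (localUnits v (Units.map ((v.adicCompletionIntegers K).subtype : _ →* _) u)) = 1)
    {ϖ : (v.adicCompletion K)ˣ} (hϖ : Valued.v (ϖ : v.adicCompletion K) = WithZero.exp (-1 : ℤ))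
    (z : (v.adicCompletion K)ˣ) {m : ℤ}
    (hz : Valued.v (z : v.adicCompletion K) = WithZero.exp (-m)) :
    Ψ (localUnits v z) = Ψ (localUnits v ϖ) ^ m := by
  have hu : Valued.v ((z * ϖ ^ (-m) : (v.adicCompletion K)ˣ) : v.adicCompletion K) = 1 := by
    rw [Units.val_mul, Units.val_zpow_eq_zpow_val, map_mul, map_zpow₀, hz, hϖ,
      ← WithZero.exp_zsmul, smul_eq_mul, ← WithZero.exp_add]
    convert WithZero.exp_zero using 2
    ring
  obtain ⟨u, hu'⟩ := exists_unitsMap_eq_of_valued_eq_one _ hu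
  have hsplit : z = (z * ϖ ^ (-m)) * ϖ ^ m := by
    rw [mul_assoc, ← zpow_add, neg_add_cancel, zpow_zero, mul_one]
  rw [hsplit, map_mul, map_mul, ← hu', hv u, one_mul, map_zpow, map_zpow]

/-- The set of finite places at which `k ∈ Kˣ` is not a unit is finite. [folklore] -/
theorem finite_setOf_valuation_ne_one (k : Kˣ) :
    {v : HeightOneSpectrum (𝓞 K) | v.valuation K (k : K) ≠ 1}.Finite := by
  refine ((HeightOneSpectrum.Support.finite (R := 𝓞 K) (k : K)).union
    (HeightOneSpectrum.Support.finite (R := 𝓞 K) ((k⁻¹ : Kˣ) : K))).subset fun v hv => ?_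
  rcases lt_or_gt_of_ne hv with h | h
  · right
    change 1 < v.valuation K ((k⁻¹ : Kˣ) : K)
    rw [Units.val_inv_eq_inv_val, map_inv₀]
    exact one_lt_inv_iff₀.mpr ⟨(Valuation.pos_iff _).mpr k.ne_zero, h⟩
  · left
    exact h

end General

/-! ### At `v ∤ ℓ` the local units have finite image under an `ℓ`-adic character -/

section Padic

variable {ℓ : ℕ} [Fact ℓ.Prime]

/-- In a normed field, an element `a` with `‖a - 1‖ < ε` for every `ε > 0` is `1`. [folklore] -/
private theorem eq_one_of_forall_norm_sub_one_lt_aux {A : Type*} [NormedField A] {a : A}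
    (h : ∀ ε : ℝ, 0 < ε → ‖a - 1‖ < ε) : a = 1 := by
  by_contra hne
  exact lt_irrefl _ (h ‖a - 1‖ (norm_pos_iff.mpr (sub_ne_zero.mpr hne)))

/-- **Continuity of `u ↦ Ψ(⟨u⟩_v)` on `𝒪_vˣ` at `1`, in valuation terms**: for every `ε > 0`
there is `e` with `‖Ψ(⟨u⟩_v) - 1‖ < ε` whenever `|u - 1|_v ≤ |ϖ_v|^e`. [folklore] -/
theorem exists_forall_valued_le_norm_sub_one_lt {A : Type*} [NormedField A]
    (Ψ : ideleGroup K →ₜ* Aˣ) (v : HeightOneSpectrum (𝓞 K)) {ε : ℝ} (hε : 0 < ε) :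
    ∃ e : ℕ, ∀ u : (v.adicCompletionIntegers K)ˣ,
      Valued.v (((u : v.adicCompletionIntegers K) : v.adicCompletion K) - 1) ≤
        WithZero.exp (-(e : ℤ)) →
      ‖((Ψ (localUnits v (Units.map ((v.adicCompletionIntegers K).subtype : _ →* _) u)) : Aˣ) :
        A) - 1‖ < ε := by
  set φ : (v.adicCompletionIntegers K)ˣ → Aˣ := fun u =>
    Ψ (localUnits v (Units.map ((v.adicCompletionIntegers K).subtype : _ →* _) u)) with hφ
  have hφc : Continuous φ := Ψ.continuous.comp (continuous_localUnits_unitsMap v)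
  have hV : IsOpen {z : Aˣ | ‖(z : A) - 1‖ < ε} :=
    isOpen_lt (continuous_norm.comp (Units.continuous_val.sub continuous_const)) continuous_const
  have h1 : φ ⁻¹' {z : Aˣ | ‖(z : A) - 1‖ < ε} ∈ 𝓝 (1 : (v.adicCompletionIntegers K)ˣ) := by
    refine hφc.continuousAt.preimage_mem_nhds (hV.mem_nhds ?_)
    have : φ 1 = 1 := by simp only [hφ, map_one]
    simp [this, hε]
  obtain ⟨U, hU, hUH⟩ := Units.exists_nhds_one_val_inv h1
  obtain ⟨e₁, he₁⟩ := adicCompletionIntegers_exists_ball_subset v hU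
  refine ⟨e₁, fun u hu => ?_⟩
  -- `|u⁻¹ - 1| = |u - 1|`
  have hunit : Valued.v (((u : v.adicCompletionIntegers K) : v.adicCompletion K)) = 1 :=
    (Valuation.Integers.isUnit_iff_valuation_eq_one
      (Valuation.valuationSubring.integers _)).1 (Units.isUnit u)
  have hinv : Valued.v ((((u⁻¹ : (v.adicCompletionIntegers K)ˣ) : v.adicCompletionIntegers K) :
      v.adicCompletion K) - 1) =
      Valued.v (((u : v.adicCompletionIntegers K) : v.adicCompletion K) - 1) := by
    have hmul : (((u⁻¹ : (v.adicCompletionIntegers K)ˣ) : v.adicCompletionIntegers K) :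
        v.adicCompletion K) * ((u : v.adicCompletionIntegers K) : v.adicCompletion K) = 1 := by
      rw [← Subring.coe_mul, ← Units.val_mul, inv_mul_cancel, Units.val_one]; rfl
    have : (((u⁻¹ : (v.adicCompletionIntegers K)ˣ) : v.adicCompletionIntegers K) :
        v.adicCompletion K) - 1 =
        (((u⁻¹ : (v.adicCompletionIntegers K)ˣ) : v.adicCompletionIntegers K) :
          v.adicCompletion K) * (1 - ((u : v.adicCompletionIntegers K) : v.adicCompletion K)) := by
      rw [mul_sub, mul_one, hmul]
    rw [this, map_mul, Valuation.map_sub_swap]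
    have h2 := congrArg Valued.v hmul
    rw [map_mul, hunit, mul_one, map_one] at h2
    rw [h2, one_mul]
  have hmem : u ∈ φ ⁻¹' {z : Aˣ | ‖(z : A) - 1‖ < ε} := by
    refine hUH u (he₁ _ hu) (he₁ _ ?_)
    rw [hinv]
    exact hu
  exact hmem

/-- **At a finite place `v ∤ ℓ`, an `ℓ`-adic character of `𝕀_K` has finite order on the local
units**: there is `N ≥ 1` with `Ψ(⟨u⟩_v)^N = 1` for every `u ∈ 𝒪_vˣ` (`Ψ : 𝕀_K →ₜ* ℚ̄_ℓˣ`
continuous).  With `q = #k_v` (prime to `ℓ`): `u^{q-1}` is a one-unit, its `q^j`-th powers tend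
to `1`, so `z = Ψ(⟨u^{(q-1)q^e}⟩_v)` is a one-unit of `ℚ̄_ℓ` all of whose `q^j`-th powers are as
close to `1` as we please while `‖z^{q^j} - 1‖ = ‖z - 1‖`; hence `z = 1`, and `N = (q - 1) q^e`.
This is the idelic form of "`ψ(I_v)` is finite for `v ∤ ℓ`" for abelian `ℓ`-adic `ψ` (Serre,
*Abelian ℓ-adic representations*, Ch. III §2.2–2.3 via the modulus of `ψ`); cf. the tree's
`ℤ_p`-valued `OneUnits.continuousMonoidHom_eq_one_of_not_mem`.
[cite: SerreAbelianLadic1968, Ch. III §2.2] -/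
theorem exists_pow_map_localUnits_eq_one_of_not_mem (Ψ : ideleGroup K →ₜ* (PadicAlgCl ℓ)ˣ)
    {v : HeightOneSpectrum (𝓞 K)} (hv : (ℓ : 𝓞 K) ∉ v.asIdeal) :
    ∃ N : ℕ, 0 < N ∧ ∀ u : (v.adicCompletionIntegers K)ˣ,
      Ψ (localUnits v (Units.map ((v.adicCompletionIntegers K).subtype : _ →* _) u)) ^ N = 1 := by
  classical
  have hp : ℓ.Prime := Fact.out
  set φ : (v.adicCompletionIntegers K)ˣ →* (PadicAlgCl ℓ)ˣ :=
    Ψ.toMonoidHom.comp ((localUnits v).comp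
      (Units.map ((v.adicCompletionIntegers K).subtype : _ →* _))) with hφdef
  have hφ : ∀ u, φ u = Ψ (localUnits v (Units.map ((v.adicCompletionIntegers K).subtype :
      _ →* _) u)) := fun u => rfl
  -- the residue field and its cardinality `q`
  haveI : Finite (IsLocalRing.ResidueField (v.adicCompletionIntegers K)) :=
    Literature.NumberTheory.Automorphic.finite_residueField_adicCompletion K v
  letI : Fintype (IsLocalRing.ResidueField (v.adicCompletionIntegers K)) := Fintype.ofFinite _
  set q : ℕ := Fintype.card (IsLocalRing.ResidueField (v.adicCompletionIntegers K)) with hq_def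
  have hq1 : 1 < q := Fintype.one_lt_card
  have hmax : ∀ z : v.adicCompletionIntegers K,
      z ∈ IsLocalRing.maximalIdeal (v.adicCompletionIntegers K) ↔
        Valued.v (z : v.adicCompletion K) < 1 := fun z => by
    rw [IsLocalRing.mem_maximalIdeal, mem_nonunits_iff]
    exact Valuation.Integer.not_isUnit_iff_valuation_lt_one
  -- `|q| < 1`
  have hqv : Valued.v ((q : v.adicCompletionIntegers K) : v.adicCompletion K) < 1 := by
    rw [← hmax, ← IsLocalRing.residue_eq_zero_iff, map_natCast, hq_def]
    exact FiniteField.cast_card_eq_zero _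
  -- `ℓ` is prime to `q`
  have hcop : Nat.Coprime ℓ q := by
    obtain ⟨p', hchar, n', hp', hcard⟩ :=
      FiniteField.card' (IsLocalRing.ResidueField (v.adicCompletionIntegers K))
    rw [hq_def, hcard]
    refine Nat.Coprime.pow_right _ ((Nat.coprime_primes hp hp').2 fun hpl => hv ?_)
    have h1 : (IsLocalRing.residue (v.adicCompletionIntegers K))
        (ℓ : v.adicCompletionIntegers K) = 0 := by
      rw [map_natCast, hpl]; exact CharP.cast_eq_zero _ p'
    rw [IsLocalRing.residue_eq_zero_iff, hmax, OneUnits.valued_natCast_adicCompletionIntegers K v ℓ] at h1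
    exact (v.intValuation_lt_one_iff_mem _).1 h1
  have hnorm : ∀ j : ℕ, ‖((q ^ j : ℕ) : PadicAlgCl ℓ)‖ = 1 := fun j =>
    PadicAlgCl.norm_natCast_eq_one_of_not_dvd fun h =>
      (Nat.Prime.coprime_iff_not_dvd hp).1 (hcop.pow_right j) h
  -- Step A: deep one-units map into the one-units of `ℚ̄_ℓ`
  obtain ⟨e₁, he₁⟩ := exists_forall_valued_le_norm_sub_one_lt Ψ v one_pos
  -- Step B: such deep one-units are killed
  have hkill : ∀ w : (v.adicCompletionIntegers K)ˣ,
      Valued.v (((w : v.adicCompletionIntegers K) : v.adicCompletion K) - 1) ≤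
        WithZero.exp (-((e₁ + 1 : ℕ) : ℤ)) → φ w = 1 := by
    intro w hw
    set y : v.adicCompletion K := ((w : v.adicCompletionIntegers K) : v.adicCompletion K)
      with hy_def
    have hwe₁ : Valued.v (y - 1) ≤ WithZero.exp (-(e₁ : ℤ)) :=
      hw.trans (WithZero.exp_le_exp.2 (by push_cast; omega))
    have hw1 : Valued.v (y - 1) < 1 :=
      hw.trans_lt (by rw [← WithZero.exp_zero, WithZero.exp_lt_exp]; push_cast; omega)
    have hz1 : ‖((φ w : (PadicAlgCl ℓ)ˣ) : PadicAlgCl ℓ) - 1‖ < 1 := he₁ w hwe₁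
    apply Units.ext
    rw [Units.val_one]
    refine eq_one_of_forall_norm_sub_one_lt_aux ?_
    intro ε hε
    obtain ⟨e, he⟩ := exists_forall_valued_le_norm_sub_one_lt Ψ v hε
    -- choose `j` with `|y^{q^j} - 1| ≤ |ϖ|^e`
    set ρ := max (Valued.v (q : v.adicCompletion K)) (Valued.v (y - 1)) with hρ_def
    have hρ1 : ρ < 1 := max_lt hqv hw1
    have hρe : ρ ≤ WithZero.exp (-1 : ℤ) := by
      by_cases hρ0 : ρ = 0
      · rw [hρ0]; exact zero_le
      · rw [← WithZero.exp_log hρ0, WithZero.exp_le_exp]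
        have : WithZero.log ρ < 0 := by
          rw [← WithZero.exp_lt_exp, WithZero.exp_log hρ0, WithZero.exp_zero]; exact hρ1
        omega
    have hj : Valued.v (y ^ q ^ e - 1) ≤ WithZero.exp (-(e : ℤ)) := by
      refine (OneUnits.valued_pow_pow_sub_one_le K v y hw1.le q e).trans ?_
      calc ρ ^ e * Valued.v (y - 1) ≤ WithZero.exp (-1 : ℤ) ^ e * 1 :=
            mul_le_mul' (pow_le_pow_left₀ zero_le hρe e) hw1.le
        _ = WithZero.exp (-(e : ℤ)) := by
            rw [mul_one, ← WithZero.exp_nsmul]; simp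
    have h2 := he (w ^ q ^ e) (by rw [Units.val_pow_eq_pow_val, Subring.coe_pow]; exact hj)
    rw [← hφ, map_pow, Units.val_pow_eq_pow_val,
      norm_pow_sub_one_of_norm_natCast_eq_one hz1 (hnorm e)] at h2
    exact h2
  -- Step C: `N = (q - 1) q^(e₁+1)`
  refine ⟨(q - 1) * q ^ (e₁ + 1), Nat.mul_pos (by omega) (pow_pos (by omega) _), fun u => ?_⟩
  rw [← hφ, ← map_pow, pow_mul]
  apply hkill
  -- `u^{q-1}` is a one-unit and its `q^(e₁+1)`-th power is deep
  set w : (v.adicCompletionIntegers K)ˣ := u ^ (q - 1) with hw_def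
  set y : v.adicCompletion K := ((w : v.adicCompletionIntegers K) : v.adicCompletion K)
    with hy_def
  have hw1 : Valued.v (y - 1) < 1 := by
    have hres : IsLocalRing.residue (v.adicCompletionIntegers K)
        ((w : v.adicCompletionIntegers K) - 1) = 0 := by
      rw [map_sub, hw_def, Units.val_pow_eq_pow_val, map_pow, hq_def,
        FiniteField.pow_card_sub_one_eq_one _ ((IsLocalRing.residue_ne_zero_iff_isUnit _).2
          (Units.isUnit u)), map_one, sub_self]
    rw [IsLocalRing.residue_eq_zero_iff, hmax] at hres
    exact hres
  set ρ := max (Valued.v (q : v.adicCompletion K)) (Valued.v (y - 1)) with hρ_def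
  have hρ1 : ρ < 1 := max_lt hqv hw1
  have hρe : ρ ≤ WithZero.exp (-1 : ℤ) := by
    by_cases hρ0 : ρ = 0
    · rw [hρ0]; exact zero_le
    · rw [← WithZero.exp_log hρ0, WithZero.exp_le_exp]
      have : WithZero.log ρ < 0 := by
        rw [← WithZero.exp_lt_exp, WithZero.exp_log hρ0, WithZero.exp_zero]; exact hρ1
      omega
  have hj : Valued.v (y ^ q ^ (e₁ + 1) - 1) ≤ WithZero.exp (-((e₁ + 1 : ℕ) : ℤ)) := by
    refine (OneUnits.valued_pow_pow_sub_one_le K v y hw1.le q (e₁ + 1)).trans ?_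
    calc ρ ^ (e₁ + 1) * Valued.v (y - 1) ≤ WithZero.exp (-1 : ℤ) ^ (e₁ + 1) * 1 :=
          mul_le_mul' (pow_le_pow_left₀ zero_le hρe (e₁ + 1)) hw1.le
      _ = WithZero.exp (-((e₁ + 1 : ℕ) : ℤ)) := by
          rw [mul_one, ← WithZero.exp_nsmul]; simp
  rw [Units.val_pow_eq_pow_val, Subring.coe_pow]
  exact hj

end Padic

/-! ### The archimedean components die on squares -/

section Archimedean

variable {A : Type*} [NormedField A] [IsUltrametricDist A]

/-- The embedding of the infinite ideles `(K ⊗ ℝ)ˣ ↪ 𝕀_K` is continuous (same statement as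
`HeckeCharacter.continuous_infiniteIdeles` of `WeakAbelianDirectSummandProofs`, not imported
here). [folklore] -/
private theorem continuous_infiniteIdeles_aux : Continuous (infiniteIdeles K) := by
  refine Continuous.units_map (MonoidHom.inl (InfiniteAdeleRing K) (FiniteAdeleRing (𝓞 K) K)) ?_
  exact continuous_id.prodMk continuous_const

omit [NumberField K] in
/-- **Squares in `K_wˣ` (`w ∣ ∞`) have `n`-th roots arbitrarily close to `1`**: for
`y ∈ K_wˣ` and `ε > 0` there are `n ≥ 1` and `t ∈ K_wˣ` with `tⁿ = y²` and `t`, `t⁻¹` within `ε`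
of `1` (`K_w = ℝ`: `t = exp(log(y²)/n)`; `K_w = ℂ`: `t = exp(log(y²)/n)` with the principal
logarithm). [folklore] -/
theorem exists_pow_eq_sq_and_dist_lt (w : InfinitePlace K) (y : (w.Completion)ˣ) {ε : ℝ}
    (hε : 0 < ε) :
    ∃ n : ℕ, 0 < n ∧ ∃ t : (w.Completion)ˣ, t ^ n = y ^ 2 ∧
      dist (t : w.Completion) 1 < ε ∧ dist ((t⁻¹ : (w.Completion)ˣ) : w.Completion) 1 < ε := by
  rcases w.isReal_or_isComplex with hw | hw
  · -- real place
    set e := InfinitePlace.Completion.ringEquivRealOfIsReal hw with he_def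
    have he : Isometry e := fun a b => InfinitePlace.Completion.isometry_extensionEmbeddingOfIsReal hw a b
    set a : ℝ := e (y : w.Completion) with ha_def
    have ha : a ≠ 0 := by
      rw [ha_def, map_ne_zero]
      exact y.ne_zero
    set c : ℝ := Real.log (a ^ 2) with hc_def
    have hexp : Real.exp c = a ^ 2 := Real.exp_log (by positivity)
    have h0 : Tendsto (fun n : ℕ => c / (n : ℝ)) atTop (𝓝 0) := tendsto_const_div_atTop_nhds_zero_nat c
    have h1 : Tendsto (fun n : ℕ => Real.exp (c / n)) atTop (𝓝 1) := by
      have := (Real.continuous_exp.tendsto 0).comp h0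
      rwa [Real.exp_zero] at this
    have h0' : Tendsto (fun n : ℕ => -(c / (n : ℝ))) atTop (𝓝 0) := by
      simpa using h0.neg
    have h2 : Tendsto (fun n : ℕ => Real.exp (-(c / n))) atTop (𝓝 1) := by
      have := (Real.continuous_exp.tendsto 0).comp h0'
      rwa [Real.exp_zero] at this
    obtain ⟨n, hn1, hn2, hn0⟩ := (((Metric.tendsto_nhds.mp h1) ε hε).and
      (((Metric.tendsto_nhds.mp h2) ε hε).and (eventually_gt_atTop 0))).exists
    set s : ℝ := Real.exp (c / n) with hs_def
    have hs0 : s ≠ 0 := (Real.exp_pos _).ne'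
    have hsn : s ^ n = a ^ 2 := by
      rw [hs_def, ← Real.exp_nat_mul, mul_div_cancel₀ _ (Nat.cast_ne_zero.mpr hn0.ne'), hexp]
    have ht0 : e.symm s ≠ 0 := by
      intro h
      apply hs0
      have := congrArg e h
      rwa [RingEquiv.apply_symm_apply, map_zero] at this
    refine ⟨n, hn0, Units.mk0 (e.symm s) ht0, Units.ext ?_, ?_, ?_⟩
    · apply e.injective
      rw [Units.val_pow_eq_pow_val, Units.val_mk0, map_pow, RingEquiv.apply_symm_apply, hsn,
        Units.val_pow_eq_pow_val, map_pow]
    · rw [Units.val_mk0, ← he.dist_eq, RingEquiv.apply_symm_apply, map_one]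
      exact hn1
    · rw [Units.val_inv_eq_inv_val, Units.val_mk0, ← map_inv₀, hs_def, ← Real.exp_neg,
        ← he.dist_eq, RingEquiv.apply_symm_apply, map_one]
      exact hn2
  · -- complex place
    set e := InfinitePlace.Completion.ringEquivComplexOfIsComplex hw with he_def
    have he : Isometry e := fun a b => InfinitePlace.Completion.isometry_extensionEmbedding w a b
    set a : ℂ := e (y : w.Completion) with ha_def
    have ha : a ≠ 0 := by
      rw [ha_def, map_ne_zero]
      exact y.ne_zero
    set c : ℂ := Complex.log (a ^ 2) with hc_def
    have hexp : Complex.exp c = a ^ 2 := Complex.exp_log (pow_ne_zero 2 ha)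
    have h0 : Tendsto (fun n : ℕ => c / (n : ℂ)) atTop (𝓝 0) := tendsto_const_div_atTop_nhds_zero_nat c
    have h1 : Tendsto (fun n : ℕ => Complex.exp (c / n)) atTop (𝓝 1) := by
      have := (Complex.continuous_exp.tendsto 0).comp h0
      rwa [Complex.exp_zero] at this
    have h0' : Tendsto (fun n : ℕ => -(c / (n : ℂ))) atTop (𝓝 0) := by
      simpa using h0.neg
    have h2 : Tendsto (fun n : ℕ => Complex.exp (-(c / n))) atTop (𝓝 1) := by
      have := (Complex.continuous_exp.tendsto 0).comp h0'
      rwa [Complex.exp_zero] at this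
    obtain ⟨n, hn1, hn2, hn0⟩ := (((Metric.tendsto_nhds.mp h1) ε hε).and
      (((Metric.tendsto_nhds.mp h2) ε hε).and (eventually_gt_atTop 0))).exists
    set s : ℂ := Complex.exp (c / n) with hs_def
    have hs0 : s ≠ 0 := Complex.exp_ne_zero _
    have hsn : s ^ n = a ^ 2 := by
      rw [hs_def, ← Complex.exp_nat_mul, mul_div_cancel₀ _ (Nat.cast_ne_zero.mpr hn0.ne'), hexp]
    have ht0 : e.symm s ≠ 0 := by
      intro h
      apply hs0
      have := congrArg e h
      rwa [RingEquiv.apply_symm_apply, map_zero] at this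
    refine ⟨n, hn0, Units.mk0 (e.symm s) ht0, Units.ext ?_, ?_, ?_⟩
    · apply e.injective
      rw [Units.val_pow_eq_pow_val, Units.val_mk0, map_pow, RingEquiv.apply_symm_apply, hsn,
        Units.val_pow_eq_pow_val, map_pow]
    · rw [Units.val_mk0, ← he.dist_eq, RingEquiv.apply_symm_apply, map_one]
      exact hn1
    · rw [Units.val_inv_eq_inv_val, Units.val_mk0, ← map_inv₀, hs_def, ← Complex.exp_neg,
        ← he.dist_eq, RingEquiv.apply_symm_apply, map_one]
      exact hn2

/-- **A continuous character `K_wˣ → Aˣ` (`w ∣ ∞`, `A` ultrametric) kills the squares**: the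
preimage of every open subgroup `U_r = {‖u - 1‖ < r}` is a neighbourhood of `1`, which contains
an `n`-th root `t` of `y²`; so `g(y²) = g(t)ⁿ ∈ U_r` for all `r`.  (In `ℝˣ` the squares are the
identity component, in `ℂˣ` everything is a square.)  Ref: Serre, *Abelian ℓ-adic
representations*, Ch. III §2.2 (an `ℓ`-adic character of `C_K` is trivial on the identity
component of `(K ⊗ ℝ)ˣ`). [folklore] -/
theorem map_infiniteIdeles_unitsMap_mulSingle_sq_eq_one [DecidableEq (InfinitePlace K)] (Ψ : ideleGroup K →ₜ* Aˣ)
    (w : InfinitePlace K) (y : (w.Completion)ˣ) :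
    Ψ (infiniteIdeles K (Units.map
      (MonoidHom.mulSingle (fun w : InfinitePlace K => w.Completion) w) (y ^ 2))) = 1 := by
  classical
  set g : (w.Completion)ˣ →* Aˣ := Ψ.toMonoidHom.comp ((infiniteIdeles K).comp
    (Units.map (MonoidHom.mulSingle (fun w : InfinitePlace K => w.Completion) w))) with hg_def
  have hg : ∀ z, g z = Ψ (infiniteIdeles K (Units.map
      (MonoidHom.mulSingle (fun w : InfinitePlace K => w.Completion) w) z)) := fun z => rfl
  have hgc : Continuous g := Ψ.continuous.comp (continuous_infiniteIdeles_aux.comp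
    (Continuous.units_map _ (continuous_mulSingle w)))
  rw [← hg]
  apply Units.ext
  rw [Units.val_one]
  refine eq_one_of_forall_norm_sub_one_lt_aux fun ε hε => ?_
  obtain ⟨U, hU, hUo⟩ := exists_subgroup_units_norm_sub_one_lt (L := A) (lt_min hε one_pos)
    (min_le_right _ _)
  have hH : (g ⁻¹' (U : Set Aˣ)) ∈ 𝓝 (1 : (w.Completion)ˣ) :=
    (hUo.preimage hgc).mem_nhds (by rw [Set.mem_preimage, map_one]; exact U.one_mem)
  obtain ⟨V, hV, hVH⟩ := Units.exists_nhds_one_val_inv hH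
  obtain ⟨δ, hδ, hball⟩ := Metric.mem_nhds_iff.mp hV
  obtain ⟨n, -, t, htn, ht1, ht2⟩ := exists_pow_eq_sq_and_dist_lt w y hδ
  have htU : g t ∈ U := hVH t (hball (Metric.mem_ball.mpr ht1)) (hball (Metric.mem_ball.mpr ht2))
  have hyU : g (y ^ 2) ∈ U := by
    rw [← htn, map_pow]
    exact U.pow_mem htU n
  exact ((hU _).1 hyU).trans_le (min_le_left _ _)

/-- **An `A`-valued continuous character of `𝕀_K` (`A` ultrametric) kills the squares of the
infinite ideles**: `Ψ((x²)_∞) = 1` for every `x ∈ (K ⊗ ℝ)ˣ` (decompose `x` along the infinite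
places). [cite: SerreAbelianLadic1968, Ch. III §2.2] -/
theorem map_infiniteIdeles_sq_eq_one (Ψ : ideleGroup K →ₜ* Aˣ) (x : (InfiniteAdeleRing K)ˣ) :
    Ψ (infiniteIdeles K (x ^ 2)) = 1 := by
  classical
  let ι : ∀ w : InfinitePlace K, (w.Completion)ˣ →* (InfiniteAdeleRing K)ˣ := fun w =>
    Units.map (MonoidHom.mulSingle (fun w : InfinitePlace K => w.Completion) w)
  let c : ∀ w : InfinitePlace K, (w.Completion)ˣ := fun w =>
    Units.map (Pi.evalMonoidHom (fun w : InfinitePlace K => w.Completion) w) x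
  have hx : x = ∏ w, ι w (c w) := by
    apply Units.ext
    rw [Units.coe_prod]
    exact (Finset.univ_prod_mulSingle (x : InfiniteAdeleRing K)).symm
  rw [hx, ← Finset.prod_pow, map_prod, map_prod]
  exact Finset.prod_eq_one fun w _ => by
    rw [← map_pow]
    exact map_infiniteIdeles_unitsMap_mulSingle_sq_eq_one Ψ w (c w)

end Archimedean

/-! ### Serre's formula for the values at global elements -/

section Values

variable {ℓ : ℕ} [Fact ℓ.Prime]

/-- **Serre's formula.**  Let `Ψ : 𝕀_K →ₜ* ℚ̄_ℓˣ` be continuous, trivial on `Kˣ` and unramified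
outside the finite set `S` (`Ψ(⟨𝒪_vˣ⟩_v) = 1` for `v ∉ S`).  There is `N ≥ 1` such that for every
`k ∈ Kˣ` which is a unit at the places of `S` not above `ℓ`, and every finite `T` disjoint from
`S` such that `k` is a unit outside `S ∪ T`,
`(∏_{v ∈ S, v ∣ ℓ} Ψ(⟨k⟩_v))^N · (∏_{v ∈ T} Ψ(⟨k⟩_v))^N = 1`.
(Product formula; `N = 2 ∏_{v ∈ S, v ∤ ℓ} N_v` kills the archimedean factor and the local units at
the places of `S` away from `ℓ`.)  This is the computation behind "`φ(x)` is algebraic for `x` in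
a subgroup of finite index of the `S_ℓ`-units" in Serre's proof that rational abelian `ℓ`-adic
representations are locally algebraic. [cite: SerreAbelianLadic1968, Ch. III §2.3 and §3] [cite: BockleHui2025, §2.4 (proof strategy for Thm. 2.2)] -/
theorem exists_pow_prod_map_localUnits_eq [DecidableEq (HeightOneSpectrum (𝓞 K))]
    [DecidablePred fun v : HeightOneSpectrum (𝓞 K) => (ℓ : 𝓞 K) ∈ v.asIdeal] (Ψ : ideleGroup K →ₜ* (PadicAlgCl ℓ)ˣ)
    (hK : ∀ x ∈ principalIdeles K, Ψ x = 1) (S : Finset (HeightOneSpectrum (𝓞 K)))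
    (hS : ∀ v ∉ S, ∀ u : (v.adicCompletionIntegers K)ˣ,
      Ψ (localUnits v (Units.map ((v.adicCompletionIntegers K).subtype : _ →* _) u)) = 1) :
    ∃ N : ℕ, 0 < N ∧ ∀ k : Kˣ,
      (∀ v ∈ S, (ℓ : 𝓞 K) ∉ v.asIdeal → v.valuation K (k : K) = 1) →
      ∀ T : Finset (HeightOneSpectrum (𝓞 K)), Disjoint S T →
        (∀ v ∉ S ∪ T, v.valuation K (k : K) = 1) →
        (∏ v ∈ S.filter (fun v => (ℓ : 𝓞 K) ∈ v.asIdeal),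
            Ψ (localUnits v (globalToLocalUnits v k))) ^ N *
          (∏ v ∈ T, Ψ (localUnits v (globalToLocalUnits v k))) ^ N = 1 := by
  -- the exponents at the places of `S` away from `ℓ`
  set Sn := S.filter (fun v => (ℓ : 𝓞 K) ∉ v.asIdeal) with hSn
  have hSn' : ∀ v ∈ Sn, (ℓ : 𝓞 K) ∉ v.asIdeal := fun v hv => (Finset.mem_filter.mp hv).2
  choose Nv hNv0 hNv using fun v : Sn =>
    exists_pow_map_localUnits_eq_one_of_not_mem Ψ (hSn' v v.2)
  set P : ℕ := ∏ v : Sn, Nv v with hP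
  have hP0 : 0 < P := Finset.prod_pos fun v _ => hNv0 v
  refine ⟨2 * P, by omega, fun k hk T hST hkT => ?_⟩
  -- product formula over `S ∪ T`
  have hpf := map_infiniteIdeles_mul_prod_localUnits_eq_one Ψ hK (S := S ∪ T)
    (fun v hv => hS v fun h => hv (Finset.mem_union_left _ h)) k hkT
  rw [Finset.prod_union hST, ← Finset.prod_filter_mul_prod_filter_not S
    (fun v => (ℓ : 𝓞 K) ∈ v.asIdeal)] at hpf
  -- the archimedean factor dies when squared
  have hinf2 : Ψ (infiniteIdeles K (globalToInfiniteUnits K k)) ^ 2 = 1 := by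
    rw [← map_pow, ← map_pow, map_infiniteIdeles_sq_eq_one]
  have hinf : Ψ (infiniteIdeles K (globalToInfiniteUnits K k)) ^ (2 * P) = 1 := by
    rw [pow_mul, hinf2, one_pow]
  -- the local units at `S` away from `ℓ` die when raised to `P`
  have hunits : (∏ v ∈ Sn, Ψ (localUnits v (globalToLocalUnits v k))) ^ (2 * P) = 1 := by
    rw [← Finset.prod_pow]
    refine Finset.prod_eq_one fun v hv => ?_
    have hval : Valued.v ((globalToLocalUnits v k : (v.adicCompletion K)ˣ) : v.adicCompletion K)
        = 1 := by
      rw [val_globalToLocalUnits, valued_algebraMap_adicCompletion]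
      exact hk v (Finset.mem_filter.mp hv).1 (hSn' v hv)
    obtain ⟨u, hu⟩ := exists_unitsMap_eq_of_valued_eq_one _ hval
    have hdvd : Nv ⟨v, hv⟩ ∣ 2 * P :=
      (Finset.dvd_prod_of_mem (fun w : Sn => Nv w) (Finset.mem_univ ⟨v, hv⟩)).mul_left 2
    obtain ⟨m, hm⟩ := hdvd
    rw [hm, pow_mul, ← hu, hNv ⟨v, hv⟩ u, one_pow]
  have h := congrArg (fun t => t ^ (2 * P)) hpf
  simp only [mul_pow, one_pow, hinf, one_mul] at h
  rw [← hSn, hunits, mul_one] at h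
  exact h

/-- **Algebraicity of the values `f(k) = ∏_{v ∣ ℓ} Ψ(⟨k⟩_v)` (the hypothesis of the `ℓ`-adic
transcendence theorem, Serre III §3 / BH Thm. 2.2, in analytic form).**  Let
`Ψ : 𝕀_K →ₜ* ℚ̄_ℓˣ` be continuous, trivial on `Kˣ`, unramified outside the finite `S`, and suppose
that the "Frobenius values" `Ψ(⟨ϖ_v⟩_v)`, `v ∉ S`, are algebraic numbers.  Then for every
`k ∈ Kˣ` which is a unit at the places of `S` not above `ℓ`, the product
`∏_{v ∈ S, v ∣ ℓ} Ψ(⟨k⟩_v)` is algebraic: by `exists_pow_prod_map_localUnits_eq` and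
`map_localUnits_eq_zpow_of_valued` its `N`-th power is `∏_{v ∈ T} Ψ(⟨ϖ_v⟩_v)^{-N ord_v k}`.
[cite: SerreAbelianLadic1968, Ch. III §3 (proof of the Theorem)] [cite: BockleHui2025, §2.4, Thm. 2.2] -/
theorem isAlgebraic_prod_map_localUnits
    [DecidablePred fun v : HeightOneSpectrum (𝓞 K) => (ℓ : 𝓞 K) ∈ v.asIdeal] (Ψ : ideleGroup K →ₜ* (PadicAlgCl ℓ)ˣ)
    (hK : ∀ x ∈ principalIdeles K, Ψ x = 1) (S : Finset (HeightOneSpectrum (𝓞 K)))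
    (hS : ∀ v ∉ S, ∀ u : (v.adicCompletionIntegers K)ˣ,
      Ψ (localUnits v (Units.map ((v.adicCompletionIntegers K).subtype : _ →* _) u)) = 1)
    (halg : ∀ v ∉ S, IsAlgebraic ℚ
      ((Ψ (localUnits v (HeckeCharacter.uniformizer K v)) : (PadicAlgCl ℓ)ˣ) : PadicAlgCl ℓ))
    (k : Kˣ) (hk : ∀ v ∈ S, (ℓ : 𝓞 K) ∉ v.asIdeal → v.valuation K (k : K) = 1) :
    IsAlgebraic ℚ ((∏ v ∈ S.filter (fun v => (ℓ : 𝓞 K) ∈ v.asIdeal),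
      Ψ (localUnits v (globalToLocalUnits v k)) : (PadicAlgCl ℓ)ˣ) : PadicAlgCl ℓ) := by
  classical
  obtain ⟨N, hN0, hN⟩ := exists_pow_prod_map_localUnits_eq Ψ hK S hS
  -- the primes of `k` away from `S`
  set T : Finset (HeightOneSpectrum (𝓞 K)) :=
    (finite_setOf_valuation_ne_one k).toFinset.filter (fun v => v ∉ S) with hT
  have hST : Disjoint S T := by
    rw [Finset.disjoint_right]
    intro v hv
    exact (Finset.mem_filter.mp hv).2
  have hkT : ∀ v ∉ S ∪ T, v.valuation K (k : K) = 1 := by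
    intro v hv
    by_contra hne
    apply hv
    rw [Finset.mem_union]
    by_cases hvS : v ∈ S
    · exact Or.inl hvS
    · exact Or.inr (Finset.mem_filter.mpr ⟨(Set.Finite.mem_toFinset _).mpr hne, hvS⟩)
  have h := hN k hk T hST hkT
  -- the `T`-factor is algebraic
  set F := algebraicClosure ℚ (PadicAlgCl ℓ) with hF
  have hTalg : ((∏ v ∈ T, Ψ (localUnits v (globalToLocalUnits v k)) : (PadicAlgCl ℓ)ˣ) :
      PadicAlgCl ℓ) ∈ F := by
    rw [Units.coe_prod]
    refine prod_mem fun v hv => ?_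
    have hvS : v ∉ S := (Finset.mem_filter.mp hv).2
    -- `Ψ(⟨k⟩_v) = Ψ(⟨ϖ_v⟩_v)^m`
    have hne : v.valuation K (k : K) ≠ 0 := (Valuation.ne_zero_iff _).mpr k.ne_zero
    set m : ℤ := -WithZero.log (v.valuation K (k : K)) with hm
    have hval : Valued.v ((globalToLocalUnits v k : (v.adicCompletion K)ˣ) :
        v.adicCompletion K) = WithZero.exp (-m) := by
      rw [val_globalToLocalUnits, valued_algebraMap_adicCompletion, hm, neg_neg,
        WithZero.exp_log hne]
    rw [map_localUnits_eq_zpow_of_valued Ψ (hS v hvS) (HeckeCharacter.valued_uniformizer v)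
      _ hval, Units.val_zpow_eq_zpow_val]
    exact zpow_mem ((mem_algebraicClosure_iff).mpr (halg v hvS)) m
  -- hence so is the `N`-th power of the `S_ℓ`-factor, and the factor itself
  refine IsAlgebraic.of_pow hN0 ?_
  rw [← mem_algebraicClosure_iff, ← hF, ← Units.val_pow_eq_pow_val]
  have h' : (∏ v ∈ S.filter (fun v => (ℓ : 𝓞 K) ∈ v.asIdeal),
      Ψ (localUnits v (globalToLocalUnits v k))) ^ N =
      ((∏ v ∈ T, Ψ (localUnits v (globalToLocalUnits v k))) ^ N)⁻¹ :=
    eq_inv_of_mul_eq_one_left h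
  rw [h', Units.val_inv_eq_inv_val, Units.val_pow_eq_pow_val]
  exact inv_mem (pow_mem hTalg N)

end Values

end IdelicCharacter

end Literature.NumberTheory.GaloisRepresentations

end
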